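import Literature.AnabelianGeometry.SemiGraphs.CoveringGraphGaloisCountable
import HarnessLib

/-!
# Route T sequel: quasi-coherence for FINITE coverings, and the hereditary invariant along towers

Mochizuki, *Semi-graphs of anabelioids*, Publ. RIMS **42** (2006), §2 Def. 2.3 (iii) p. 25 and
Rmk. 2.4.1 p. 26 (hypotheses of §2 pass to finite étale coverings) [cite: MochizukiSemiAnbd2006,
Rmk 2.4.1 p.26]: for a FINITE object `S` of `B^cov(G)` with fibres of cardinality `≤ D` over a
quasi-coherent `G` (no coherence needed), the covering semi-graph of anabelioids `G_S`
(`CovObj.coveringGraph`) is quasi-coherent — over each constituent there are finitely many orbits,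
so the finite intersection `U_c := ⨅_ω N'_{(c,ω)}` of the pointwise stabilisers is open of index
`≤ (max 1 (D · M!))^D`, and the mechanism `isQuasiCoherent_coveringGraph_of_le_fixatorIn` of
`CoveringGraphGaloisCountable` (over the restricted image approximator of `CoveringGraphApproximators`,
abc-iut-L3-t5) applies.  Also the bundle-free corollary for `S` finite over a CONNECTED quasi-coherent
`G` (constant degree).

Second part — **the hereditary invariant of route T**: the conjunction «hypotheses of Thm. 3.7 ∧
strictly coherent ∧ Thm 3.7 (iii) AT the graph» passes from `G` to `G_S` for every connected tempered
`S` (`routeTInvariant_coveringGraph`), hence climbs towers of connected tempered coverings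
(`Ÿ → Y → X`); with it the bodies of Thm. 3.7 (iii)/(iv) hold at every stage
(`compactInVerticial_body_of_routeTInvariant`, `maximalCompactIffVerticialAt_of_routeTInvariant`),
every finite coherent Thm-3.7 graph starts a tower (`routeTInvariant_of_finite`,
`routeTInvariant_coveringGraph_coveringGraph`).

Proof-only (abc-iut cell, L3 route T, sequel to bricks C/D/E; seat abc-iut-L3-d6); no definition;
nothing here bears on [IUTchIII] Cor. 3.12.  NOT claimed: Thm 3.7 (iii) for an arbitrary countable
infinite `G` (the ∀-form is the object of REFUTE-F1732).
-/

open CategoryTheory Topology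

namespace Literature.AnabelianGeometry.SemiGraphs

namespace ProfiniteSemiGraph

namespace CovObj

open Literature.AlgebraicGeometry.Frobenioids (IsConnectedObj)

universe u

variable {𝒢 : ProfiniteSemiGraph.{u}} (S : CovObj 𝒢)

/-! ### Quasi-coherence is hereditary: finite `S` over quasi-coherent `G` (print's scope) -/

/-- The stabiliser of a point of a finite object has nonzero index at most the cardinality of the
object (orbit–stabiliser). [cite: MochizukiSemiAnbd2006, §3 p.33] -/
theorem index_stab_le_card {G : Type u} [Group G] [TopologicalSpace G] (X : BTemp G)
    [Finite X.obj.V] (s : X.obj.V) :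
    (BTemp.stab X s).index ≠ 0 ∧ (BTemp.stab X s).index ≤ Nat.card X.obj.V := by
  letI : MulAction G X.obj.V := Action.instMulAction X.obj
  have heq : BTemp.stab X s = MulAction.stabilizer G s := Subgroup.ext fun _ => Iff.rfl
  have h2 : (MulAction.stabilizer G s).index = Nat.card (MulAction.orbit G s) :=
    Nat.card_congr (MulAction.orbitEquivQuotientStabilizer G s).symm
  have h3 : Nat.card (MulAction.orbit G s) ≤ Nat.card X.obj.V :=
    Nat.card_le_card_of_injective (fun y : MulAction.orbit G s => (y : X.obj.V))
      Subtype.val_injective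
  have h4 : Nat.card (MulAction.orbit G s) ≠ 0 :=
    Nat.card_ne_zero.mpr ⟨⟨⟨s, MulAction.mem_orbit_self s⟩⟩, inferInstance⟩
  rw [heq, h2]
  exact ⟨h4, h3⟩

/-- **Quasi-coherence of `G_S` for FINITE `S` of bounded degree over a quasi-coherent `G`** (Rmk.
2.4.1's scope "finite étale covering"): over each constituent there are finitely many orbits `ω`, and
`U_c := ⨅_ω N'_{(c,ω)}` is open of index `≤ (max 1 (D · M!))^D`.
[cite: MochizukiSemiAnbd2006, Rmk 2.4.1 p.26] -/
theorem isQuasiCoherent_coveringGraph_of_card_le (hq : 𝒢.IsQuasiCoherent) (hfin : S.IsFinite)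
    {D : ℕ} (hDV : ∀ v : 𝒢.graph.Vertex, Nat.card (S.SV v).obj.V ≤ D)
    (hDE : ∀ e : 𝒢.graph.Edge, Nat.card (S.SE e).obj.V ≤ D) :
    S.coveringGraph.IsQuasiCoherent := by
  classical
  haveI : ∀ v, Finite (S.SV v).obj.V := hfin.finite_V
  haveI : ∀ e, Finite (S.SE e).obj.V := hfin.finite_E
  refine S.isQuasiCoherent_coveringGraph_of_le_fixatorIn hq fun M HV HE hHV hHE => ?_
  haveI : ∀ v', Finite (HV v').obj.V := fun v' => (hHV v').2
  haveI : ∀ e', Finite (HE e').obj.V := fun e' => (hHE e').2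
  -- finitely many orbits over each constituent
  haveI hOV : ∀ v : 𝒢.graph.Vertex, Finite (BTemp.Orbits (S.SV v)) := fun v =>
    Finite.of_surjective _ Quot.mk_surjective
  haveI hOE : ∀ e : 𝒢.graph.Edge, Finite (BTemp.Orbits (S.SE e)) := fun e =>
    Finite.of_surjective _ Quot.mk_surjective
  letI : ∀ v : 𝒢.graph.Vertex, Fintype (BTemp.Orbits (S.SV v)) := fun v => Fintype.ofFinite _
  letI : ∀ e : 𝒢.graph.Edge, Fintype (BTemp.Orbits (S.SE e)) := fun e => Fintype.ofFinite _
  let K : ℕ := max 1 (D * M.factorial)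
  -- the `N'_{(c,ω)}` and their indices
  let NV : ∀ v : 𝒢.graph.Vertex, BTemp.Orbits (S.SV v) → Subgroup (𝒢.Gv v) := fun v ω =>
    fixatorIn (BTemp.stab (S.SV v) (Quot.out ω)) (HV ⟨v, ω⟩)
  let NE : ∀ e : 𝒢.graph.Edge, BTemp.Orbits (S.SE e) → Subgroup (𝒢.Ge e) := fun e ω =>
    fixatorIn (BTemp.stab (S.SE e) (Quot.out ω)) (HE ⟨e, ω⟩)
  have hNV : ∀ v ω, IsOpen (NV v ω : Set (𝒢.Gv v)) ∧ (NV v ω).index ≠ 0 ∧ (NV v ω).index ≤ K :=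
    fun v ω => by
    obtain ⟨h0, hle⟩ := index_stab_le_card (S.SV v) (Quot.out ω)
    obtain ⟨h0', hle'⟩ := index_fixatorIn_le _ h0 (hle.trans (hDV v)) (HV ⟨v, ω⟩) (hHV ⟨v, ω⟩).1
    exact ⟨isOpen_fixatorIn _ ((S.SV v).property.2 _) _, h0', hle'.trans (le_max_right _ _)⟩
  have hNE : ∀ e ω, IsOpen (NE e ω : Set (𝒢.Ge e)) ∧ (NE e ω).index ≠ 0 ∧ (NE e ω).index ≤ K :=
    fun e ω => by
    obtain ⟨h0, hle⟩ := index_stab_le_card (S.SE e) (Quot.out ω)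
    obtain ⟨h0', hle'⟩ := index_fixatorIn_le _ h0 (hle.trans (hDE e)) (HE ⟨e, ω⟩) (hHE ⟨e, ω⟩).1
    exact ⟨isOpen_fixatorIn _ ((S.SE e).property.2 _) _, h0', hle'.trans (le_max_right _ _)⟩
  -- number of orbits `≤ D`
  have hcOV : ∀ v, Fintype.card (BTemp.Orbits (S.SV v)) ≤ D := fun v => by
    rw [← Nat.card_eq_fintype_card]
    exact (Nat.card_le_card_of_surjective _ Quot.mk_surjective).trans (hDV v)
  have hcOE : ∀ e, Fintype.card (BTemp.Orbits (S.SE e)) ≤ D := fun e => by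
    rw [← Nat.card_eq_fintype_card]
    exact (Nat.card_le_card_of_surjective _ Quot.mk_surjective).trans (hDE e)
  have hK : 1 ≤ K := le_max_left _ _
  refine ⟨K ^ D, fun v => ⨅ ω, NV v ω, fun e => ⨅ ω, NE e ω, fun v => ⟨?_, ?_, ?_⟩,
    fun e => ⟨?_, ?_, ?_⟩, fun v' => iInf_le (NV v'.1) v'.2, fun e' => iInf_le (NE e'.1) e'.2⟩
  · rw [Subgroup.coe_iInf]
    exact isOpen_iInter_of_finite fun ω => (hNV v ω).1
  · exact Subgroup.index_iInf_ne_zero fun ω => (hNV v ω).2.1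
  · calc (⨅ ω, NV v ω).index ≤ ∏ ω, (NV v ω).index := Subgroup.index_iInf_le _
      _ ≤ ∏ _ω : BTemp.Orbits (S.SV v), K := Finset.prod_le_prod' fun ω _ => (hNV v ω).2.2
      _ = K ^ Fintype.card (BTemp.Orbits (S.SV v)) := by rw [Finset.prod_const, Finset.card_univ]
      _ ≤ K ^ D := Nat.pow_le_pow_right hK (hcOV v)
  · rw [Subgroup.coe_iInf]
    exact isOpen_iInter_of_finite fun ω => (hNE e ω).1
  · exact Subgroup.index_iInf_ne_zero fun ω => (hNE e ω).2.1
  · calc (⨅ ω, NE e ω).index ≤ ∏ ω, (NE e ω).index := Subgroup.index_iInf_le _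
      _ ≤ ∏ _ω : BTemp.Orbits (S.SE e), K := Finset.prod_le_prod' fun ω _ => (hNE e ω).2.2
      _ = K ^ Fintype.card (BTemp.Orbits (S.SE e)) := by rw [Finset.prod_const, Finset.card_univ]
      _ ≤ K ^ D := Nat.pow_le_pow_right hK (hcOE e)

/-- **Quasi-coherence of `G_S` for FINITE `S` over a CONNECTED quasi-coherent `G`** (the fibres of `S`
have constant cardinality on the connected `G`). [cite: MochizukiSemiAnbd2006, Rmk 2.4.1 p.26] -/
theorem isQuasiCoherent_coveringGraph_of_isFinite (hconn : 𝒢.IsConnected) (hq : 𝒢.IsQuasiCoherent)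
    (hfin : S.IsFinite) : S.coveringGraph.IsQuasiCoherent := by
  obtain ⟨n₀⟩ := hconn.connected.nonempty
  refine S.isQuasiCoherent_coveringGraph_of_card_le hq hfin (D := S.nodeCard n₀) (fun v => ?_)
    fun e => ?_
  · exact (S.nodeCard_eq_of_reachable (hconn.connected.preconnected (Sum.inl v) n₀)).le
  · exact (S.nodeCard_eq_of_reachable (hconn.connected.preconnected (Sum.inr (Sum.inl e)) n₀)).le


/-! ### The hereditary invariant of route T along towers of connected tempered coverings -/

/-- **Route T's invariant is hereditary**: if `G` satisfies the hypotheses of Thm. 3.7, is strictly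
coherent, and satisfies Thm 3.7 (iii) AT `G` (`CompactInVerticialAt`), then so does the covering
semi-graph of anabelioids `G_S` of every connected tempered covering `S` (hypotheses:
`thm37Hypotheses_coveringGraph`; strict coherence: `isStrictlyCoherent_coveringGraph`; (iii): the route-T
transfer `compactInVerticialAt_coveringGraph'`).  Iterating, the invariant climbs every finite tower of
connected tempered coverings. [cite: MochizukiSemiAnbd2006, Thm 3.7(iii) pp.40-41] -/
theorem routeTInvariant_coveringGraph (h37 : 𝒢.Thm37Hypotheses) (hsc : 𝒢.IsStrictlyCoherent)
    (hiii : CompactInVerticialAt 𝒢) (hS : S.IsTempered)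
    (hSc : IsConnectedObj (⟨S, hS⟩ : BTempCat 𝒢)) :
    S.coveringGraph.Thm37Hypotheses ∧ S.coveringGraph.IsStrictlyCoherent ∧
      CompactInVerticialAt S.coveringGraph :=
  ⟨S.thm37Hypotheses_coveringGraph h37 hsc hS hSc, S.isStrictlyCoherent_coveringGraph h37.isConnected
    hsc hS hSc, S.compactInVerticialAt_coveringGraph' h37 hsc.isCoherent hiii hS⟩

/-- Every FINITE coherent Thm-3.7 graph of anabelioids carries the invariant (Thm 3.7 (iii) at finite
graphs: `compactInVerticialAt_of_finiteGraph`). [cite: MochizukiSemiAnbd2006, Thm 3.7(iii) pp.40-41] -/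
theorem _root_.Literature.AnabelianGeometry.SemiGraphs.ProfiniteSemiGraph.routeTInvariant_of_finite
    [Finite 𝒢.graph.Vertex] [Finite 𝒢.graph.Edge] (h37 : 𝒢.Thm37Hypotheses) (hcoh : 𝒢.IsCoherent) :
    𝒢.Thm37Hypotheses ∧ 𝒢.IsStrictlyCoherent ∧ CompactInVerticialAt 𝒢 :=
  ⟨h37, isStrictlyCoherent_of_finite ⟨‹_›, ‹_›⟩ hcoh, compactInVerticialAt_of_finiteGraph⟩

/-- Under the invariant, the BODY of Thm 3.7 (iii) holds at the graph (unfold the At-form at its own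
hypotheses) — so at every stage of a tower. [cite: MochizukiSemiAnbd2006, Thm 3.7(iii) pp.40-41] -/
theorem _root_.Literature.AnabelianGeometry.SemiGraphs.ProfiniteSemiGraph.compactInVerticial_body_of_routeTInvariant
    (h : 𝒢.Thm37Hypotheses ∧ 𝒢.IsStrictlyCoherent ∧ CompactInVerticialAt 𝒢) (c : TemperedPiChart 𝒢)
    (C : Subgroup c.G) (hC : IsCompact (C : Set c.G)) :
    (∃ (v : 𝒢.graph.Vertex) (H : Subgroup c.G), H ∈ verticialSubgroups c v ∧ C ≤ H) ∧
      (C ≠ ⊥ → ∀ (v₁ v₂ : 𝒢.graph.Vertex) (H₁ H₂ : Subgroup c.G), H₁ ∈ verticialSubgroups c v₁ →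
        H₂ ∈ verticialSubgroups c v₂ → H₁ ≠ H₂ → C ≤ H₁ → C ≤ H₂ →
          (∀ (v₃ : 𝒢.graph.Vertex) (H₃ : Subgroup c.G), H₃ ∈ verticialSubgroups c v₃ → C ≤ H₃ →
              H₃ = H₁ ∨ H₃ = H₂) ∧
          ∃ (e : 𝒢.graph.Edge) (L : Subgroup c.G), 𝒢.graph.IsClosedEdge e ∧
            L ∈ edgeLikeSubgroups c e ∧ C ≤ L) :=
  h.2.2 h.1 c C hC

/-- Under the invariant at `G`, the body of Thm 3.7 (iv) holds at `G_S` for every connected tempered `S`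
(the route-T transfer of (iv)). [cite: MochizukiSemiAnbd2006, Thm 3.7(iv) p.41] -/
theorem maximalCompactIffVerticialAt_of_routeTInvariant
    (h : 𝒢.Thm37Hypotheses ∧ 𝒢.IsStrictlyCoherent ∧ CompactInVerticialAt 𝒢) (hS : S.IsTempered)
    (hSc : IsConnectedObj (⟨S, hS⟩ : BTempCat 𝒢)) (c : TemperedPiChart S.coveringGraph) :
    (∀ K : Subgroup c.G, IsMaximalCompactSubgroup K ↔ ∃ w, K ∈ verticialSubgroups c w) ∧
    ∀ L : Subgroup c.G, L ≠ ⊥ →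
      ((∃ K₁ K₂ : Subgroup c.G, IsMaximalCompactSubgroup K₁ ∧ IsMaximalCompactSubgroup K₂ ∧
          K₁ ≠ K₂ ∧ L = K₁ ⊓ K₂) ↔
        ∃ e, S.coveringGraph.graph.IsClosedEdge e ∧ L ∈ edgeLikeSubgroups c e) :=
  S.maximalCompactIffVerticialAt_coveringGraph' h.1 h.2.1.isCoherent h.2.2 hS
    (S.thm37Hypotheses_coveringGraph h.1 h.2.1 hS hSc) c

/-- **Two-step towers** (`Ÿ → Y → X`): for `S` a connected tempered covering of a finite coherent
Thm-3.7 graph `G` and `S'` a connected tempered covering of `G_S`, the covering semi-graph `(G_S)_{S'}`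
again carries the invariant — in particular the bodies of Thm 3.7 (iii)/(iv) hold there.
[cite: MochizukiSemiAnbd2006, Thm 3.7(iii) pp.40-41] -/
theorem routeTInvariant_coveringGraph_coveringGraph [Finite 𝒢.graph.Vertex] [Finite 𝒢.graph.Edge]
    (h37 : 𝒢.Thm37Hypotheses) (hcoh : 𝒢.IsCoherent) (hS : S.IsTempered)
    (hSc : IsConnectedObj (⟨S, hS⟩ : BTempCat 𝒢)) (S' : CovObj S.coveringGraph) (hS' : S'.IsTempered)
    (hS'c : IsConnectedObj (⟨S', hS'⟩ : BTempCat S.coveringGraph)) :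
    S'.coveringGraph.Thm37Hypotheses ∧ S'.coveringGraph.IsStrictlyCoherent ∧
      CompactInVerticialAt S'.coveringGraph :=
  have h := S.routeTInvariant_coveringGraph h37 (isStrictlyCoherent_of_finite ⟨‹_›, ‹_›⟩ hcoh)
    compactInVerticialAt_of_finiteGraph hS hSc
  S'.routeTInvariant_coveringGraph h.1 h.2.1 h.2.2 hS' hS'c

end CovObj

end ProfiniteSemiGraph

end Literature.AnabelianGeometry.SemiGraphs

-- tree-health (abc-iut-w6-d081 g4, 2026-08-26T12:44Z): comment-only re-land of a STRANDED ACCEPT (module accepted, not importable on the farm for > 60 min);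
-- declarations byte-identical to the accepted version; purpose = trigger the rebuild (w4-d014 10:34:09Z remedy class). No content change.
-- tree-health (abc-iut-w6-d081 g4, 2026-08-26T14:24Z): second comment-only re-land — the 12:44Z re-land batch did not regain a farm olean in 95 min while the 12:55Z and 13:5xZ batches did within ≈20 min (suspected dispatch gap at 12:44Z); declarations byte-identical.
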